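import Summits.CriticalPhenomena.PercolationContinuityZ3.Theses.PercNonProliferation
import Summits.CriticalPhenomena.PercolationContinuityZ3.Theorems.NonProliferation.Negative.AboveSix
import Summits.CriticalPhenomena.PercolationContinuityZ3.Theorems.PercNonProliferationNonProliferationStubBoundaryGrid
import Summits.CriticalPhenomena.PercolationContinuityZ3.Theorems.PercNonProliferationNonProliferationStubMidSphereCrossers
import Summits.CriticalPhenomena.PercolationContinuityZ3.Theorems.PercNonProliferationNonProliferationStubMultiCrossAtShift
import Summits.CriticalPhenomena.PercolationContinuityZ3.Theorems.PercNonProliferationNonProliferationOfThreeCrosserDecay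
import Summits.CriticalPhenomena.PercolationContinuityZ3.Theorems.PercNonProliferationSpanningBKCap
import Literature.Probability.Percolation.RSW
import HarnessLib

/-!
# Crux `PercNonProliferation.NonProliferation` (stmt-CriticalPhenomena-4444), line `boundary-pinning` —
# the RATIO DICHOTOMY: blocking at ANY fixed aspect ratio, along ANY subsequence, implies the crux

Lead's composition file (prover-line-stmt-CriticalPhenomena-4444-c2; skeleton
`Cruxes/NonProliferation/Lines/boundary_pinning.lean`, gen 5, theorem `NonProliferation_of_blocking`).
Lands with `--supports stmt-CriticalPhenomena-4444`; closes nothing by itself.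

The bulk covering of the line (`nonProliferation_of_threeCrosserDecay`, landed) turns ANY smallness of
the large-ratio multi-crosser probability — `(r+1)` points of `B(m)`, each joined inside `B(km)` to
`∂ⁱⁿB(km)`, pairwise NOT joined inside `B(km)` — into the crux. Here the smallness is supplied by the
van den Berg–Kesten–Reimer inequality instead of a conjectured exponent:

* `real_multiCross_le_pow` (BK at general ratio, every `d`, `p`, `r`, `m`, `L`): the `(r+1)`-crosser
  event has probability `≤ P_p(B(m) ↔ ∂ⁱⁿB(L) inside B(L))^{r+1}` (distinct clusters of the graph induced on
  `B(L)` carry pairwise edge-disjoint open crossing walks: `setOf_distinctClusters_subset_disjointOccurrencePow`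
  and `measureReal_disjointOccurrencePow_le`, both in tree; the route's `SpanningBKCap` is the case `L = 2m`).
* `nonProliferation_of_frequently_multiCross` (the covering in its weakest form): if for some ratio `k ≥ 2`
  and multiplicity `r`, for INFINITELY MANY `m`, `726 k² · P_{p_c}((r+1)-crosser event of B(km) ∖ B(m)) ≤ 1/2`,
  then `NonProliferation` (with `M = 726 r k²`, `c = 1/2`, along `n = 2km + 2`).
* `nonProliferation_of_frequently_blocked` (**the dichotomy, positive half**): if for some ratio `k ≥ 2` the
  critical annulus `B(km) ∖ B(m)` is BLOCKED (no open path inside `B(km)` from `B(m)` to `∂ⁱⁿB(km)`) with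
  probability `≥ δ > 0` for infinitely many `m`, then `NonProliferation`: choose `r` with
  `726 k² (1-δ)^{r+1} ≤ 1/2` and use BK.
* `crossing_tendsto_one_of_not_nonProliferation` (**negative half, for the disprover**): if the crux fails,
  then at EVERY fixed ratio `k ≥ 2` the critical annulus of `ℤ³` is crossed inside `B(km)` with probability
  tending to one as `m → ∞` — the sure-crossing regime. This extends the `M = 0` / ratio-2 slice
  `Negative.MZeroSlice.annulusCrossing_tendsto_one_of_not_nonProliferation` to all ratios; in particular
  any refutation of the crux must first refute every RSW-type lower bound on blocking at every aspect ratio,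
  and every proof of the crux may assume sure crossing at all ratios (where the line's two open stubs live).

Calibration: the bridge is dimension-free and correctly idle above six dimensions, where blocking → 0 at
every ratio (Aizenman 1997) and the crux is false (`Negative.nonProliferation_false_without_dimThree`).
-/

noncomputable section

namespace Summit.CriticalPhenomena.PercolationContinuityZ3.Theorems.NonProliferation

open MeasureTheory Filter Topology
open Literature.Probability.LatticeModels Literature.Probability.Percolation
open Summit.CriticalPhenomena.PercolationContinuityZ3.Theorems.NonProliferation.Negative

namespace RatioDichotomy

/-- **BK at general ratio.** For every `d`, `p`, `r`, `m`, `L`: the probability that `r+1` points of `B(m)`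
are each joined inside `B(L)` to `∂ⁱⁿB(L)` and pairwise not joined inside `B(L)` is at most
`P_p(B(m) ↔ ∂ⁱⁿB(L) inside B(L))^{r+1}` (the points lie in distinct clusters of the open graph induced on
`B(L)`, whose crossing walks are pairwise edge-disjoint witnesses of the local increasing crossing event;
iterated van den Berg–Kesten–Reimer). [folklore] -/
theorem real_multiCross_le_pow (d r m L : ℕ) (p : unitInterval) :
    (bondPercolation (zdGraph d) p).real
        {ω | ∃ x : Fin (r + 1) → Site d, (∀ i, x i ∈ box d m) ∧
          (∀ i, ∃ y ∈ innerBoundary (zdGraph d) (box d L),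
            ω ∈ openConnIn (↑(box d L) : Set (Site d)) (x i) y) ∧
          ∀ i j, i ≠ j → ω ∉ openConnIn (↑(box d L) : Set (Site d)) (x i) (x j)} ≤
      ((bondPercolation (zdGraph d) p).real
        (openCrossing (↑(box d L) : Set (Site d)) ↑(box d m) ↑(innerBoundary (zdGraph d) (box d L)))) ^
        (r + 1) := by
  have hA : IsLocalEvent (openCrossing (↑(box d L) : Set (Site d)) ↑(box d m)
      ↑(innerBoundary (zdGraph d) (box d L))) :=
    isLocalEvent_openCrossing _ _ _
  exact (measureReal_mono (setOf_distinctClusters_subset_disjointOccurrencePow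
      (↑(box d L) : Set (Site d)) ↑(box d m) ↑(innerBoundary (zdGraph d) (box d L)) r)).trans
    (measureReal_disjointOccurrencePow_le (zdGraph d) p hA (r + 1))

/-- The crossing event `{B(m) ↔ ∂ⁱⁿB(L) inside B(L)}` spelled with `∃ x ∈ B(m), ∃ y ∈ ∂ⁱⁿB(L), x ↔ y in B(L)`
IS `openCrossing ↑B(L) ↑B(m) ↑∂ⁱⁿB(L)`. -/
theorem setOf_crossing_eq_openCrossing (d m L : ℕ) :
    {ω : BondConfig (Site d) | ∃ x ∈ box d m, ∃ y ∈ innerBoundary (zdGraph d) (box d L),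
        ω ∈ openConnIn (↑(box d L) : Set (Site d)) x y} =
      openCrossing (↑(box d L) : Set (Site d)) ↑(box d m) ↑(innerBoundary (zdGraph d) (box d L)) := by
  ext ω
  simp only [Set.mem_setOf_eq, mem_openCrossing_iff, Finset.mem_coe]

/-- The crossing event is measurable (a local event of the finite box). -/
theorem measurableSet_crossing (d m L : ℕ) :
    MeasurableSet {ω : BondConfig (Site d) | ∃ x ∈ box d m, ∃ y ∈ innerBoundary (zdGraph d) (box d L),
        ω ∈ openConnIn (↑(box d L) : Set (Site d)) x y} := by
  rw [setOf_crossing_eq_openCrossing]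
  exact measurableSet_openCrossing _ _ _

end RatioDichotomy

open RatioDichotomy

/-- **The bulk covering in its weakest form: frequently-small multi-crosser probability at one ratio gives the
crux.** If for some ratio `k ≥ 2` and multiplicity `r`, for infinitely many `m`,
`726 k² · P_{p_c(ℤ³)}((r+1) points of B(m), each joined inside B(km) to ∂ⁱⁿB(km), pairwise unjoined inside B(km)) ≤ 1/2`,
then `NonProliferation` holds with `M = 726 r k²`, `c = 1/2`, along the scales `n = 2km + 2` (mid-sphere grid of
`≤ 726k²` cells of side `m+1` on `∂ⁱⁿB(n+km+1)`, `stub_boundaryGrid`; `r·#cells + 1` box-distinct crossers put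
`r+1` through one cell, `stub_midSphereCrossers`; translation invariance `stub_multiCrossAt_shift`; union bound). -/
theorem nonProliferation_of_frequently_multiCross :
    (∃ k r : ℕ, 2 ≤ k ∧ ∃ᶠ m : ℕ in atTop,
      726 * (k : ℝ) ^ 2 * (bondPercolation (zdGraph 3) (criticalProbI 3)).real
        {ω | ∃ x : Fin (r + 1) → Site 3, (∀ i, x i ∈ box 3 m) ∧
          (∀ i, ∃ y ∈ innerBoundary (zdGraph 3) (box 3 (k * m)),
            ω ∈ openConnIn (↑(box 3 (k * m)) : Set (Site 3)) (x i) y) ∧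
          ∀ i j, i ≠ j → ω ∉ openConnIn (↑(box 3 (k * m)) : Set (Site 3)) (x i) (x j)} ≤ 1 / 2) →
    Summit.CriticalPhenomena.PercolationContinuityZ3.Theses.PercNonProliferation.NonProliferation := by
  classical
  rintro ⟨k, r, hk, hfreq⟩
  rw [nonProliferation_iff]
  set μ : Measure (BondConfig (Site 3)) := bondPercolation (zdGraph 3) (criticalProbI 3) with hμ
  refine ⟨r * (726 * k ^ 2), 1 / 2, by norm_num, ?_⟩
  -- transfer `∃ᶠ m` to `∃ᶠ n` along `n = 2km + 2`
  rw [frequently_atTop]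
  intro N
  obtain ⟨m, hmN, hsmall⟩ := frequently_atTop.1 (hfreq.and_eventually (eventually_ge_atTop 1)) (N + 1)
  obtain ⟨hsmall, hm1⟩ := hsmall
  have hk0 : 0 < 2 * k := by omega
  refine ⟨2 * k * m + 2, ?_, ?_⟩
  · have : N ≤ m := by omega
    calc N ≤ m := this
      _ ≤ 2 * k * m := Nat.le_mul_of_pos_left m hk0
      _ ≤ 2 * k * m + 2 := by omega
  set n : ℕ := 2 * k * m + 2 with hn
  have h2km : 2 * k * m + 2 ≤ n := le_rfl
  have hn' : n ≤ 2 * k * (m + 1) + 2 := by rw [hn]; nlinarith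
  -- the translated / centred multi-crosser events
  set At : Site 3 → Set (BondConfig (Site 3)) := fun z =>
    {ω | ∃ x : Fin (r + 1) → Site 3, (∀ i, x i ∈ GM.ball z m) ∧
      (∀ i, ∃ y ∈ innerBoundary (zdGraph 3) (GM.ball z (k * m)),
        ω ∈ openConnIn (↑(GM.ball z (k * m)) : Set (Site 3)) (x i) y) ∧
      ∀ i j, i ≠ j → ω ∉ openConnIn (↑(GM.ball z (k * m)) : Set (Site 3)) (x i) (x j)} with hAt
  set A0 : Set (BondConfig (Site 3)) :=
    {ω | ∃ x : Fin (r + 1) → Site 3, (∀ i, x i ∈ box 3 m) ∧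
      (∀ i, ∃ y ∈ innerBoundary (zdGraph 3) (box 3 (k * m)),
        ω ∈ openConnIn (↑(box 3 (k * m)) : Set (Site 3)) (x i) y) ∧
      ∀ i j, i ≠ j → ω ∉ openConnIn (↑(box 3 (k * m)) : Set (Site 3)) (x i) (x j)} with hA0
  -- grid on the mid-sphere `∂ⁱⁿB(n + km + 1)`, cell side `m + 1`, non-empty cells, chosen points
  obtain ⟨𝒬, hsub, hdiam, -, hcov, hcount⟩ := stub_boundaryGrid 3 (n + k * m + 1) (m + 1) (by omega)
  set 𝒬' : Finset (Finset (Site 3)) := 𝒬.filter (fun Q => Q.Nonempty) with h𝒬'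
  set z : Finset (Site 3) → Site 3 := fun Q => if h : Q.Nonempty then h.choose else 0 with hz
  have hz_mem : ∀ Q ∈ 𝒬', z Q ∈ Q := by
    intro Q hQ
    have hne : Q.Nonempty := (Finset.mem_filter.1 hQ).2
    simp only [hz, dif_pos hne]
    exact hne.choose_spec
  have hsub' : ∀ Q ∈ 𝒬', Q ⊆ innerBoundary (zdGraph 3) (box 3 (n + k * m + 1)) :=
    fun Q hQ => hsub Q (Finset.mem_filter.1 hQ).1
  have hdiam' : ∀ Q ∈ 𝒬', ∀ u ∈ Q, ∀ v ∈ Q, ∀ i : Fin 3, |u i - v i| ≤ (m : ℤ) := by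
    intro Q hQ u hu v hv i
    have h := hdiam Q (Finset.mem_filter.1 hQ).1 u hu v hv i
    push_cast at h
    linarith
  have hcov' : ∀ y ∈ innerBoundary (zdGraph 3) (box 3 (n + k * m + 1)), ∃ Q ∈ 𝒬', y ∈ Q := by
    intro y hy
    obtain ⟨Q, hQ, hyQ⟩ := hcov y hy
    exact ⟨Q, Finset.mem_filter.2 ⟨hQ, ⟨y, hyQ⟩⟩, hyQ⟩
  have hcard' : (𝒬'.card : ℝ) ≤ 726 * (k : ℝ) ^ 2 := by
    have h1 : (𝒬'.card : ℝ) ≤ 𝒬.card := by exact_mod_cast Finset.card_filter_le _ _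
    have h2 : (𝒬.card : ℝ) ≤
        2 * (3 : ℝ) * (2 * ((n + k * m + 1 : ℕ) : ℝ) / ((m + 1 : ℕ) : ℝ) + 2) ^ (3 - 1) := by
      exact_mod_cast hcount
    exact h1.trans (h2.trans (BulkCovering.count_le hk hm1 h2km hn'))
  have hcardN : 𝒬'.card ≤ 726 * k ^ 2 := by exact_mod_cast hcard'
  -- `r+1` crossers through one cell (a.e.), union bound, translation, smallness
  have hincl : ∀ᵐ ω ∂μ, ω ∈ repEvent 3 (r * 𝒬'.card) n → ω ∈ ⋃ Q ∈ 𝒬', At (z Q) := by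
    filter_upwards [ae_subset_edgeSet (zdGraph 3) (criticalProbI 3)] with ω hω hrep
    obtain ⟨Q, hQ, x, hx⟩ :=
      stub_midSphereCrossers 3 n k m r 𝒬' z ω hm1 (by omega) h2km hω hsub' hz_mem hdiam' hcov' hrep
    exact Set.mem_biUnion hQ ⟨x, hx⟩
  have hP0 : 726 * (k : ℝ) ^ 2 * μ.real A0 ≤ 1 / 2 := hsmall
  have hunion : μ.real (repEvent 3 (r * 𝒬'.card) n) ≤ 1 / 2 := by
    calc μ.real (repEvent 3 (r * 𝒬'.card) n)
        ≤ μ.real (⋃ Q ∈ 𝒬', At (z Q)) := by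
          simp only [measureReal_def]
          exact ENNReal.toReal_mono (measure_ne_top _ _) (measure_mono_ae hincl)
      _ ≤ ∑ Q ∈ 𝒬', μ.real (At (z Q)) := measureReal_biUnion_finset_le _ _
      _ = ∑ Q ∈ 𝒬', μ.real A0 :=
          Finset.sum_congr rfl fun Q _ => stub_multiCrossAt_shift 3 r m (k * m) (criticalProbI 3) (z Q)
      _ = 𝒬'.card * μ.real A0 := by rw [Finset.sum_const, nsmul_eq_mul]
      _ ≤ 726 * (k : ℝ) ^ 2 * μ.real A0 := by gcongr
      _ ≤ 1 / 2 := hP0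
  have hM : r * 𝒬'.card ≤ r * (726 * k ^ 2) := Nat.mul_le_mul_left r hcardN
  have hmono : μ.real (repEvent 3 (r * (726 * k ^ 2)) n) ≤ μ.real (repEvent 3 (r * 𝒬'.card) n) :=
    measureReal_mono (repEvent_antitone 3 n hM) (measure_ne_top _ _)
  rw [probReal_compl_eq_one_sub (measurableSet_repEvent 3 _ n)]
  linarith

/-- **Ratio dichotomy, positive half: blocking at one fixed ratio, along a subsequence, implies the crux.**
If for some ratio `k ≥ 2` and some `δ > 0`, for infinitely many `m`, the critical annulus `B(km) ∖ B(m)` of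
`ℤ³` carries NO open path inside `B(km)` from `B(m)` to `∂ⁱⁿB(km)` with probability `≥ δ`, then
`NonProliferation`. Proof: BK at ratio `k` (`real_multiCross_le_pow`) bounds the `(r+1)`-crosser probability
by `(1-δ)^{r+1}` at those `m`; pick `r` with `726k²(1-δ)^{r+1} ≤ 1/2` and apply
`nonProliferation_of_frequently_multiCross`. (The ratio-2, all-`n`, `M = 0` case is
`Negative.nonProliferation_of_critAnnulusNonCrossing`.) -/
theorem nonProliferation_of_frequently_blocked :
    (∃ k : ℕ, 2 ≤ k ∧ ∃ δ : ℝ, 0 < δ ∧ ∃ᶠ m : ℕ in atTop,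
      δ ≤ (bondPercolation (zdGraph 3) (criticalProbI 3)).real
        {ω | ¬ ∃ x ∈ box 3 m, ∃ y ∈ innerBoundary (zdGraph 3) (box 3 (k * m)),
          ω ∈ openConnIn (↑(box 3 (k * m)) : Set (Site 3)) x y}) →
    Summit.CriticalPhenomena.PercolationContinuityZ3.Theses.PercNonProliferation.NonProliferation := by
  rintro ⟨k, hk, δ, hδ, hfreq⟩
  set μ : Measure (BondConfig (Site 3)) := bondPercolation (zdGraph 3) (criticalProbI 3) with hμ
  -- the multiplicity: `726 k² (1-δ)^{r+1} ≤ 1/2`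
  have hδ1 : δ ≤ 1 := by
    obtain ⟨m, -, hm⟩ := frequently_atTop.1 hfreq 0
    exact hm.trans measureReal_le_one
  have hq0 : 0 ≤ 1 - δ := by linarith
  have hq1 : 1 - δ < 1 := by linarith
  have hKpos : (0 : ℝ) < 726 * (k : ℝ) ^ 2 := by positivity
  obtain ⟨r, hr⟩ := exists_pow_lt_of_lt_one (show (0 : ℝ) < 1 / (2 * (726 * (k : ℝ) ^ 2)) by positivity) hq1
  refine nonProliferation_of_frequently_multiCross ⟨k, r, hk, hfreq.mono fun m hm => ?_⟩
  -- at a blocked scale: `P((r+1)-crosser) ≤ P(cross)^{r+1} ≤ (1-δ)^{r+1} ≤ (1-δ)^r`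
  have hcross : μ.real (openCrossing (↑(box 3 (k * m)) : Set (Site 3)) ↑(box 3 m)
      ↑(innerBoundary (zdGraph 3) (box 3 (k * m)))) ≤ 1 - δ := by
    have hc := probReal_compl_eq_one_sub (μ := μ) (measurableSet_crossing 3 m (k * m))
    rw [setOf_crossing_eq_openCrossing] at hc
    have hm' : δ ≤ μ.real (openCrossing (↑(box 3 (k * m)) : Set (Site 3)) ↑(box 3 m)
        ↑(innerBoundary (zdGraph 3) (box 3 (k * m))))ᶜ := by
      convert hm using 2
      ext ω
      simp only [Set.mem_compl_iff, mem_openCrossing_iff, Finset.mem_coe, Set.mem_setOf_eq]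
    linarith
  have hpow : μ.real
      {ω | ∃ x : Fin (r + 1) → Site 3, (∀ i, x i ∈ box 3 m) ∧
        (∀ i, ∃ y ∈ innerBoundary (zdGraph 3) (box 3 (k * m)),
          ω ∈ openConnIn (↑(box 3 (k * m)) : Set (Site 3)) (x i) y) ∧
        ∀ i j, i ≠ j → ω ∉ openConnIn (↑(box 3 (k * m)) : Set (Site 3)) (x i) (x j)} ≤ (1 - δ) ^ r := by
    calc μ.real _ ≤ (μ.real (openCrossing (↑(box 3 (k * m)) : Set (Site 3)) ↑(box 3 m)
          ↑(innerBoundary (zdGraph 3) (box 3 (k * m))))) ^ (r + 1) := real_multiCross_le_pow 3 r m (k * m) _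
      _ ≤ (1 - δ) ^ (r + 1) := by gcongr
      _ ≤ (1 - δ) ^ r := pow_le_pow_of_le_one hq0 hq1.le (Nat.le_succ r)
  calc 726 * (k : ℝ) ^ 2 * μ.real _ ≤ 726 * (k : ℝ) ^ 2 * (1 - δ) ^ r := by gcongr
    _ ≤ 726 * (k : ℝ) ^ 2 * (1 / (2 * (726 * (k : ℝ) ^ 2))) := by gcongr
    _ = 1 / 2 := by field_simp

/-- **Ratio dichotomy, negative half: if the crux fails, the critical annulus of `ℤ³` is crossed with
probability tending to one at EVERY fixed aspect ratio.** For every `k ≥ 2`,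
`P_{p_c(ℤ³)}(B(m) ↔ ∂ⁱⁿB(km) inside B(km)) → 1` as `m → ∞` (contrapositive of
`nonProliferation_of_frequently_blocked`; extends `Negative.annulusCrossing_tendsto_one_of_not_nonProliferation`,
the ratio-2 case, to all ratios). So every refutation of the crux refutes RSW-type blocking bounds at all
aspect ratios first, and every proof of the crux may assume the sure-crossing regime. -/
theorem crossing_tendsto_one_of_not_nonProliferation
    (h : ¬ Summit.CriticalPhenomena.PercolationContinuityZ3.Theses.PercNonProliferation.NonProliferation)
    {k : ℕ} (hk : 2 ≤ k) :
    Tendsto (fun m : ℕ => (bondPercolation (zdGraph 3) (criticalProbI 3)).real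
      {ω | ∃ x ∈ box 3 m, ∃ y ∈ innerBoundary (zdGraph 3) (box 3 (k * m)),
        ω ∈ openConnIn (↑(box 3 (k * m)) : Set (Site 3)) x y}) atTop (𝓝 1) := by
  set μ : Measure (BondConfig (Site 3)) := bondPercolation (zdGraph 3) (criticalProbI 3) with hμ
  rw [tendsto_order]
  refine ⟨fun a ha => ?_, fun a ha => Eventually.of_forall fun m => measureReal_le_one.trans_lt ha⟩
  by_contra hnot
  have hfreq : ∃ᶠ m : ℕ in atTop, μ.real
      {ω | ∃ x ∈ box 3 m, ∃ y ∈ innerBoundary (zdGraph 3) (box 3 (k * m)),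
        ω ∈ openConnIn (↑(box 3 (k * m)) : Set (Site 3)) x y} ≤ a := by
    simpa only [not_eventually, not_lt] using hnot
  refine h (nonProliferation_of_frequently_blocked ⟨k, hk, 1 - a, by linarith, hfreq.mono fun m hm => ?_⟩)
  rw [show {ω : BondConfig (Site 3) | ¬ ∃ x ∈ box 3 m, ∃ y ∈ innerBoundary (zdGraph 3) (box 3 (k * m)),
        ω ∈ openConnIn (↑(box 3 (k * m)) : Set (Site 3)) x y} =
      {ω : BondConfig (Site 3) | ∃ x ∈ box 3 m, ∃ y ∈ innerBoundary (zdGraph 3) (box 3 (k * m)),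
        ω ∈ openConnIn (↑(box 3 (k * m)) : Set (Site 3)) x y}ᶜ from rfl,
    probReal_compl_eq_one_sub (measurableSet_crossing 3 m (k * m))]
  linarith

end Summit.CriticalPhenomena.PercolationContinuityZ3.Theorems.NonProliferation

end
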